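import Summits.BirchSwinnertonDyer.BirchSwinnertonDyer.Theorems.ByReductionTypeAtTwoAdditiveOddBranchFEDoor
import Literature.NumberTheory.EllipticCurves.IwasawaSelmerQuadraticLayerDualProofs
import Literature.NumberTheory.EllipticCurves.Kato2004.IwasawaInvolutionTwistSelmerProofs
import Literature.NumberTheory.GaloisRepresentations.AbsGaloisGroup
import HarnessLib

/-!
# Route ByReductionTypeAtTwo, crux `AdditivePotMultOverKAtTwo` (stmt-BirchSwinnertonDyer-22618; parent
# `AdditiveRankZeroAtTwo` 19098) — T20 (a) «twist decomposition» IN THE KERNEL modulo the model identification: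
# the reading `hdec` of `…AdditiveKatoTransportSymmetry` PROVED in the tree's subgroup model of `Sel(E′/ℚ_∞(i))`,
# and the (−1)-split-twist-block doors with `hdec` / `hXι` replaced by Greenberg 1.14 (PRINT ×2) + KERNEL + ONE
# displayed identification of `Sel((E′)_F/F_∞)` with that model

Cell `bsd-2adic`, seat `bsd-2adic-t42` GEN 23 (addL2x GEN 16's «NEXT SEAT R-B79 (1)»). Sequel of
`Literature/…/IwasawaSelmerQuadraticLayerDecomposition` (the `±`-decomposition of `Sel(E′/ℚ_∞(θ))` along the
quadratic layer INSIDE `Γ_ℚ`: kernel and cokernel killed by `4`), `…IwasawaSelmerQuadraticLayerDualProofs` (its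
Pontryagin dual: `X_F → X(E′/ℚ_∞) × X(E/ℚ_∞)` is a `Λ`-quasi-isomorphism, so HEIGHT-ONE LENGTHS AWAY FROM `(2)` ADD
and torsion transfers) and `…IwasawaSelmerDualFunctorialityProofs`. HONEST FRAMING (D-0036 / D-0054): theorems only;
types-the-object-of (READING → KERNEL modulo one displayed model identification); closes none; nothing booked; BSD is
not proved by any of this. PARTITION: X5@2 additive, C4″ 22618 (−1)-split-twist block (and, through k4-w3's R15
kernel, the (−2)-block) × `p = 2`.

What is displayed, and why it is only bookkeeping. Greenberg's Thm 1.14 over `F` is transcribed in the tree for the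
BASE-CHANGE Selmer group `Sel_{2^∞}((E′)_F/F_∞) ⊆ H¹(Gal(F̄/F_∞), ·)` (`(V.baseChange F).SelmerDualData κ_F γ_F`), while
the decomposition is proved (and can only be proved) inside `Γ_ℚ`, for the tree's model
`W′.selmerGroupOver 2 (kerStab κ θ)` of `Sel_{2^∞}(E′/ℚ_∞(θ))` (`SubgroupSelmer`: «for `H = Gal(K̄/L)` this is
`Sel_{p^∞}(E/L)`»). The two are the same group `Sel(E′/F_∞)`, `F = ℚ(θ)`, `F_∞ = ℚ_∞(θ)`; the identification
`hΘS` (an additive isomorphism commuting with `conj_γ`) is displayed as ONE hypothesis — Selmer base change along the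
finite Galois extension `F/ℚ` at the infinite level, NOT yet in the tree (WANTED: a successor / Stage B of this seat).

* §1 over `ℚ`: `√−1 ∈ ℚ̄` (`exists_sqrt_neg_one`); a complex conjugation `c ∈ ker κ` with `c·θ = −θ`
  (`exists_mem_kerSubgroup_smul_sqrt_eq_neg`: `c² = 1` and `ℤ₂` is torsion-free; `ι(cθ) = conj(±I) = −ι(θ)`).
* §2 **`hdec_of_model`**: `ℓ_𝔮(D_F.X) = ℓ_𝔮(D′.X) + ℓ_𝔮(D.X)` at every prime `𝔮 ∌ C 2` — the hypothesis `hdec` of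
  `AddKatoTwo.lengthAt_selmerDual_symm_of_decomposition` — from the model identification alone; `isTorsion_model_iff`.
* §3 **`lengthAt_selmerDual_symm_of_model`**: `ℓ_𝔮(X(E/ℚ_∞)) = ℓ_{ι𝔮}(X(E/ℚ_∞))` at every height-one `𝔮 ∌ 2` for the
  ADDITIVE `E = W` from {`Greenberg1999_thm114_charIdeal_iota_invariant`, `…_splitMult_baseChange` (PRINT), torsion of
  `X(E′/ℚ_∞)` and `X(E/ℚ_∞)`, the model identification} — T20 (a) BY NAME with `hdec` DISCHARGED.
* §4 the doors: `lengthAt_selmerDualContra_le_of_oddBranchInputsPrintExact_fe_of_model` (key `γ⁻¹`, PRINT-EXACT typed input,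
  FE kernel — addL2x p683821 / t42 GEN 21 — with `hXsym` DISCHARGED) and `lengthAt_selmerDual_le_of_oddBranchInputsPrintExact_fe_of_model`
  (key `γ`).

References: [GreenbergLNM1716] §1 p. 60, Thm. 1.14 p. 68, §4 p. 107; [DokchitserDokchitserAnnals2010] Lemma 4.14;
[Kato2004Asterisque] Thm. 12.4, 12.5 (3), §17.13; [MazurTateTeitelbaum1986Invent] §I.17; memo
`run/shared/lean/pub/bsd-2adic/t42/DESIGN-T42-ADDENDUM-27.md`.
-/

set_option autoImplicit false
-- the summit's namespace `Summit.BirchSwinnertonDyer.BirchSwinnertonDyer` (Sub = Summit) trips `dupNamespace`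
set_option linter.dupNamespace false

noncomputable section

open scoped Classical MatrixGroups ModularForm NumberField

open Field CongruenceSubgroup WeierstrassCurve IsDedekindDomain
  Literature.NumberTheory.EllipticCurves Literature.NumberTheory.EllipticCurves.ModularForms
  Literature.NumberTheory.EllipticCurves.Module Literature.NumberTheory.EllipticCurves.QuadraticLayer
  Literature.NumberTheory.GaloisRepresentations

namespace Summit.BirchSwinnertonDyer.BirchSwinnertonDyer.Theorems.AddKatoTwoQuadLayer

universe v

/-! ## §1 The quadratic layer `ℚ_∞(i)/ℚ_∞`: `θ = √−1` and a complex conjugation in `ker κ` -/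

/-- `√−1 ∈ ℚ̄`. [folklore] -/
theorem exists_sqrt_neg_one :
    ∃ θ : AlgebraicClosure ℚ, θ ^ 2 = algebraMap ℚ (AlgebraicClosure ℚ) (-1) := by
  obtain ⟨θ, hθ⟩ := IsAlgClosed.exists_eq_mul_self (-1 : AlgebraicClosure ℚ)
  exact ⟨θ, by rw [sq, ← hθ, map_neg, map_one]⟩

/-- **A complex conjugation lies in `ker κ` and negates `√−1`**: for ANY `ℤ_p`-extension `κ` of `ℚ` and `θ² = −1`
there is `c ∈ ker κ` with `c·θ = −θ` — a complex conjugation `c` (tree: `exists_isComplexConjugation`) has `c² = 1`,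
so `2·κ(c) = 0` in the torsion-free `ℤ_p`, and under an embedding `ι : ℚ̄ → ℂ` extending `ℚ ⊂ ℝ`,
`ι(cθ) = conj(ι θ) = conj(±i) = −ι θ`. [cite: Washington1997, §13.1] -/
theorem exists_mem_kerSubgroup_smul_sqrt_eq_neg {p : ℕ} [Fact p.Prime] (κ : ZpExtension ℚ p)
    {θ : AlgebraicClosure ℚ} (hθ : θ ^ 2 = algebraMap ℚ (AlgebraicClosure ℚ) (-1)) :
    ∃ c : absoluteGaloisGroup ℚ, c ∈ κ.kerSubgroup ∧ c • θ = -θ := by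
  obtain ⟨c, hc⟩ := exists_isComplexConjugation (Rat.castHom ℝ)
  obtain ⟨ι, -, hι⟩ := isComplexConjugation_iff.mp hc
  refine ⟨c, ?_, ?_⟩
  · -- `c² = 1`, `ℤ_p` torsion-free
    rw [ZpExtension.mem_kerSubgroup]
    have h2 : orderOf c = 2 := hc.orderOf_eq_two
    have hcc : c * c = 1 := by rw [← pow_two, ← h2, pow_orderOf_eq_one]
    have hκ : κ c * κ c = 1 := by rw [← map_mul, hcc, map_one]
    have hadd : (κ c).toAdd + (κ c).toAdd = 0 := by
      rw [← toAdd_mul, hκ, toAdd_one]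
    have h0 : (κ c).toAdd = 0 := by
      rw [← two_mul] at hadd
      rcases mul_eq_zero.mp hadd with h | h
      · exfalso
        have h2' : (2 : ℤ_[p]) = ((2 : ℕ) : ℤ_[p]) := by norm_num
        rw [h2'] at h
        exact (Nat.cast_ne_zero.mpr (by norm_num : (2 : ℕ) ≠ 0)) h
      · exact h
    exact Multiplicative.toAdd.injective (by rw [h0, toAdd_one])
  · -- `ι (c θ) = conj (ι θ) = -ι θ`
    have hθ2 : (ι θ) ^ 2 = -1 := by
      rw [← map_pow, hθ, map_neg, map_one]
      simp
    have him : ι θ = Complex.I ∨ ι θ = -Complex.I := by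
      have h : (ι θ) ^ 2 = Complex.I ^ 2 := by rw [hθ2, Complex.I_sq]
      exact sq_eq_sq_iff_eq_or_eq_neg.mp h
    have hconj : starRingEnd ℂ (ι θ) = -ι θ := by
      rcases him with h | h
      · rw [h, Complex.conj_I]
      · rw [h, map_neg, Complex.conj_I, neg_neg]
    apply ι.injective
    rw [hι θ, hconj, map_neg]

/-! ## §2 The decomposition reading `hdec`, modulo the model identification -/

section Model

variable (κ : ZpExtension ℚ 2) (W' W : WeierstrassCurve ℚ) {V : VariableChange ℚ}
  (hV : V • W = W'.quadraticTwist (-1))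
  {θ : AlgebraicClosure ℚ} (hθ : θ ^ 2 = algebraMap ℚ (AlgebraicClosure ℚ) (-1))
  {γ : absoluteGaloisGroup ℚ} (hγθ : γ • θ = θ)
  -- the model: ANY base field `F`, curve `WF/F`, tower `κF`, generator `γF`, and an identification of Selmer groups
  {F : Type v} [Field F] [NumberField F] {WF : WeierstrassCurve F} {κF : ZpExtension F 2}
  {γF : absoluteGaloisGroup F} [(kerStab κ θ).Normal]
  (ΘS : WF.selmerInfty κF ≃+ W'.selmerGroupOver 2 (kerStab κ θ))
  (hΘS : ∀ s, ((ΘS (WF.conjSelmerInfty κF γF s) : W'.selmerGroupOver 2 (kerStab κ θ)) : W'.subgroupH1 2 (kerStab κ θ)) =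
    W'.conjH1 2 (kerStab κ θ) γ (ΘS s : W'.selmerGroupOver 2 (kerStab κ θ)))
  (D' : W'.SelmerDualData κ γ) (D : W.SelmerDualData κ γ) (DF : WF.SelmerDualData κF γF)

/-- `(2 : Λ) = C 2`. [folklore] -/
private theorem two_eq_C : (2 : IwasawaAlgebra 2) = PowerSeries.C (2 : ℤ_[2]) := by
  rw [show (2 : ℤ_[2]) = ((2 : ℕ) : ℤ_[2]) by norm_num, map_natCast]; norm_num

include hV hθ hγθ hΘS in
/-- **THE DECOMPOSITION READING `hdec` OF T20 (a), KERNEL modulo the model identification**: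
`ℓ_𝔮(D_F.X) = ℓ_𝔮(X(E′/ℚ_∞)) + ℓ_𝔮(X(E/ℚ_∞))` at every prime `𝔮 ∌ C 2` of `Λ = ℤ₂⟦T⟧`, for `E′ = W′`, `E = W` a
`ℚ`-model of `E′^{(−1)}`, `θ = √−1`, `γ` fixing `θ` (WLOG: `SelmerDualData.rekey`), and ANY dual datum `D_F` whose Selmer
group is identified with the subgroup model of `Sel(E′/ℚ_∞(θ))` compatibly with `conj`. EXACTLY the hypothesis `hdec` of
`AddKatoTwo.lengthAt_selmerDual_symm_of_decomposition` (which needs it only at height-one `𝔮`).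
[cite: GreenbergLNM1716, §4 p. 107] [cite: DokchitserDokchitserAnnals2010, Lemma 4.14] -/
theorem hdec_of_model (𝔮 : PrimeSpectrum (IwasawaAlgebra 2)) (hp𝔮 : PowerSeries.C (2 : ℤ_[2]) ∉ 𝔮.asIdeal) :
    lengthAt (IwasawaAlgebra 2) DF.X 𝔮 =
      lengthAt (IwasawaAlgebra 2) D'.X 𝔮 + lengthAt (IwasawaAlgebra 2) D.X 𝔮 := by
  obtain ⟨c, hcκ, hcθ⟩ := exists_mem_kerSubgroup_smul_sqrt_eq_neg κ hθ
  have h1 : (-1 : ℚ) ≠ 0 := by norm_num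
  exact lengthAt_eq_add_of_quadraticLayer κ W' W h1 hV hθ hcκ hcθ hγθ ΘS hΘS D' D DF 𝔮 (by rw [two_eq_C]; exact hp𝔮)

include hγθ hΘS hV hθ in
/-- **Torsion transfers through the model**: `D_F` torsion ⟺ `X(E′/ℚ_∞)` and `X(E/ℚ_∞)` torsion.
[cite: DokchitserDokchitserAnnals2010, Lemma 4.14] -/
theorem isTorsion_model_iff : DF.IsTorsion ↔ D'.IsTorsion ∧ D.IsTorsion := by
  obtain ⟨c, hcκ, hcθ⟩ := exists_mem_kerSubgroup_smul_sqrt_eq_neg κ hθ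
  have h1 : (-1 : ℚ) ≠ 0 := by norm_num
  exact isTorsion_iff_of_quadraticLayer κ W' W h1 hV hθ hcκ hcθ hγθ ΘS hΘS D' D DF

end Model

/-! ## §3 T20 (a): the `ι`-symmetry of the height-one lengths of `X(E/ℚ_∞)` for the additive curve -/

section Symmetry

variable (h114 : Greenberg1999_thm114_charIdeal_iota_invariant)
  (h114F : Greenberg1999.thm114_charIdeal_iota_invariant_splitMult_baseChange)
  (W' : WeierstrassCurve ℚ) [W'.IsElliptic] [W'.IsGloballyMinimal] (hmult' : W'.HasMultiplicativeReductionAtPrime 2)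
  (W : WeierstrassCurve ℚ) {V : VariableChange ℚ} (hV : V • W = W'.quadraticTwist (-1))
  {θ : AlgebraicClosure ℚ} (hθ : θ ^ 2 = algebraMap ℚ (AlgebraicClosure ℚ) (-1))
  (κ : ZpExtension ℚ 2) (γ : absoluteGaloisGroup ℚ) (hκ : κ.IsCyclotomic) (hγ : κ.IsTopGenerator γ) (hγθ : γ • θ = θ)
  (D' : W'.SelmerDualData κ γ) [Module.Finite (IwasawaAlgebra 2) D'.X] (hD' : D'.IsTorsion)
  (D : W.SelmerDualData κ γ) (hD : D.IsTorsion)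
  -- the model of `Sel(E′/ℚ_∞(θ))` over a number field `F` where `E′` is split multiplicative above `2` (intended `F = ℚ(i)`)
  (F : Type) [Field F] [NumberField F]
  (hF : ∀ v : HeightOneSpectrum (𝓞 F), (2 : 𝓞 F) ∈ v.asIdeal → (W'.baseChange F).HasSplitMultiplicativeReductionAt v)
  (κF : ZpExtension F 2) (γF : absoluteGaloisGroup F) (hκF : κF.IsCyclotomic) (hγF : κF.IsTopGenerator γF)
  (DF : (W'.baseChange F).SelmerDualData κF γF) [Module.Finite (IwasawaAlgebra 2) DF.X] [(kerStab κ θ).Normal]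
  (ΘS : (W'.baseChange F).selmerInfty κF ≃+ W'.selmerGroupOver 2 (kerStab κ θ))
  (hΘS : ∀ s, ((ΘS ((W'.baseChange F).conjSelmerInfty κF γF s) : W'.selmerGroupOver 2 (kerStab κ θ)) :
      W'.subgroupH1 2 (kerStab κ θ)) = W'.conjH1 2 (kerStab κ θ) γ (ΘS s : W'.selmerGroupOver 2 (kerStab κ θ)))

include h114 h114F hmult' hV hθ hκ hγ hγθ hD' hD hF hκF hγF DF hΘS in
/-- **T20 (a) BY NAME with `hdec` DISCHARGED: `ℓ_𝔮(X(E/ℚ_∞)) = ℓ_{ι𝔮}(X(E/ℚ_∞))` at every height-one `𝔮 ∌ 2`** for the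
ADDITIVE curve `E = W` (`W` a `ℚ`-model of `E′^{(−1)}`, `E′ = W′` multiplicative at `2`), from Greenberg's Thm 1.14 over
`ℚ` (for `X(E′/ℚ_∞)`) and over `F` (for `X((E′)_F/F_∞)`, `E′` split multiplicative above `2`) — the tree's two PRINT facts
— the torsion of `X(E′/ℚ_∞)`, `X(E/ℚ_∞)`, and the model identification `ΘS`. Kernel: the quadratic-layer decomposition
(`hdec_of_model`), torsion transfer (`isTorsion_model_iff`), then `AddKatoTwo.lengthAt_selmerDual_symm_of_decomposition`.
[cite: GreenbergLNM1716, Thm. 1.14 (p. 68) and §1 (p. 60)] [cite: DokchitserDokchitserAnnals2010, Lemma 4.14] -/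
theorem lengthAt_selmerDual_symm_of_model (𝔮 : PrimeSpectrum (IwasawaAlgebra 2)) (h𝔮 : 𝔮.asIdeal.height = 1)
    (hp𝔮 : PowerSeries.C (2 : ℤ_[2]) ∉ 𝔮.asIdeal) :
    lengthAt (IwasawaAlgebra 2) D.X 𝔮 =
      lengthAt (IwasawaAlgebra 2) D.X (PrimeSpectrum.comap (IwasawaAlgebra.invol 2).toRingHom 𝔮) := by
  have hDF : DF.IsTorsion := (isTorsion_model_iff κ W' W hV hθ hγθ ΘS hΘS D' D DF).mpr ⟨hD', hD⟩
  exact AddKatoTwo.lengthAt_selmerDual_symm_of_decomposition h114 h114F W' hmult' F hF κF γF hκF hγF DF hDF κ γ hκ hγ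
    D' hD' D (fun 𝔮' _ hp𝔮' ↦ hdec_of_model κ W' W hV hθ hγθ ΘS hΘS D' D DF 𝔮' hp𝔮') 𝔮 h𝔮 hp𝔮

end Symmetry

/-! ## §4 The (−1)-split-twist-block doors with T20 (a) discharged modulo the model identification -/

section Doors

variable (h12 : Kato2004.thm12_4) (hPE : AddKatoTwo.KatoOddBranchInputsAtTwoNegOneSplitTwistPrintExact)
  (h114 : Greenberg1999_thm114_charIdeal_iota_invariant)
  (h114F : Greenberg1999.thm114_charIdeal_iota_invariant_splitMult_baseChange)
  -- the additive curve `W` on the (−1)-block and a globally minimal model `W′` of its twist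
  (W : WeierstrassCurve ℚ) [W.IsElliptic] [W.IsGloballyMinimal] [ContinuousSMul ℤ_[2] (W.tateModule 2)]
  (W' : WeierstrassCurve ℚ) [W'.IsElliptic] [W'.IsGloballyMinimal] (hmult' : W'.HasMultiplicativeReductionAtPrime 2)
  {V : VariableChange ℚ} (hV : V • W = W'.quadraticTwist (-1))
  {θ : AlgebraicClosure ℚ} (hθ : θ ^ 2 = algebraMap ℚ (AlgebraicClosure ℚ) (-1))
  {N : ℕ} [NeZero N] (f : CuspForm (Gamma0 N) 2) (κ : ZpExtension ℚ 2) (γ : absoluteGaloisGroup ℚ)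
  (hsp : (W.quadraticTwist (-1)).HasSplitMultiplicativeReductionAtPrime 2)
  (hirr : W.HasIrreducibleModPGaloisRep 2) (hκ : κ.IsCyclotomic) (hγ : κ.IsTopGenerator γ)
  (hγ' : IsCyclotomicVariable 2 γ) (hγθ : γ • θ = θ) (hf : IsNewformOf (W.quadraticTwist (-1)) f)
  (I : Kato2004.IwasawaH1Data W 2 κ γ)
  -- torsion of the two `ℚ`-side Iwasawa modules (key `γ`)
  (D₀' : W'.SelmerDualData κ γ) [Module.Finite (IwasawaAlgebra 2) D₀'.X] (hD₀' : D₀'.IsTorsion)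
  (D₀ : W.SelmerDualData κ γ) (hD₀ : D₀.IsTorsion)
  -- the model
  (F : Type) [Field F] [NumberField F]
  (hF : ∀ v : HeightOneSpectrum (𝓞 F), (2 : 𝓞 F) ∈ v.asIdeal → (W'.baseChange F).HasSplitMultiplicativeReductionAt v)
  (κF : ZpExtension F 2) (γF : absoluteGaloisGroup F) (hκF : κF.IsCyclotomic) (hγF : κF.IsTopGenerator γF)
  (DF : (W'.baseChange F).SelmerDualData κF γF) [Module.Finite (IwasawaAlgebra 2) DF.X] [(kerStab κ θ).Normal]
  (ΘS : (W'.baseChange F).selmerInfty κF ≃+ W'.selmerGroupOver 2 (kerStab κ θ))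
  (hΘS : ∀ s, ((ΘS ((W'.baseChange F).conjSelmerInfty κF γF s) : W'.selmerGroupOver 2 (kerStab κ θ)) :
      W'.subgroupH1 2 (kerStab κ θ)) = W'.conjH1 2 (kerStab κ θ) γ (ΘS s : W'.selmerGroupOver 2 (kerStab κ θ)))
  -- the `2`-adic `L`-function side
  (Lt : IwasawaAlgebra 2) (m : ℕ)
  (hLt : iwasawaToPowerSeries 2 Lt =
    PowerSeries.C ((2 : ℚ_[2]) ^ m) * padicLFunctionMinusBranchMult f (1 : ℚ_[2]) 1)
  (hLt0 : Lt ≠ 0)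

include h12 hPE h114 h114F hmult' hV hθ hsp hirr hκ hγ hγ' hγθ hf I hD₀' hD₀ hF hκF hγF DF hΘS hLt hLt0 in
/-- **KEY-`γ⁻¹` PRINT-EXACT DOOR with T20 (a) and T20 (d) in the kernel (modulo the model)**: `ℓ_𝔮(X′) ≤ ℓ_𝔮(Λ/(L̃))` at every
height-one `𝔮 ∌ 2` for every key-`γ⁻¹` dual Selmer datum `D′` of the ADDITIVE `W` (`W^{(−1)}` split multiplicative at
`2`, `W[2]` irreducible), from `Kato2004.thm12_4` (PRINT), the PRINT-EXACT typed input
`KatoOddBranchInputsAtTwoNegOneSplitTwistPrintExact`, Greenberg 1.14 ×2 (PRINT), the torsion of `X(W′/ℚ_∞)`, `X(W/ℚ_∞)`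
(key `γ`), the model identification, and `L̃ = 2^m L⁻ ≠ 0` — `MultOddBranchFE.…_of_lengthAt_symm_fe` with `hXsym`
DISCHARGED by `lengthAt_selmerDual_symm_of_model` transported to the key `γ⁻¹` (`Kato2004.selmerDualData_lengthAt_inv_eq`).
[cite: Kato2004Asterisque, Thm. 12.4 (2) (p. 221), Thm. 12.5 (3) and (12.5.1) (p. 222), §17.13 (pp. 279–280)]
[cite: GreenbergLNM1716, Thm. 1.14 (p. 68)] [cite: MazurTateTeitelbaum1986Invent, §I.17] -/
theorem lengthAt_selmerDualContra_le_of_oddBranchInputsPrintExact_fe_of_model (D' : W.SelmerDualData κ γ⁻¹)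
    (𝔮 : PrimeSpectrum (IwasawaAlgebra 2)) (h𝔮 : 𝔮.asIdeal.height = 1) (hp𝔮 : PowerSeries.C (2 : ℤ_[2]) ∉ 𝔮.asIdeal) :
    lengthAt (IwasawaAlgebra 2) D'.X 𝔮 ≤ lengthAt (IwasawaAlgebra 2) (IwasawaAlgebra 2 ⧸ Ideal.span {Lt}) 𝔮 := by
  haveI : Fact (Nat.Prime 2) := ⟨Nat.prime_two⟩
  -- the conjugate prime
  set 𝔮' := PrimeSpectrum.comap (IwasawaAlgebra.invol 2).toRingHom 𝔮 with h𝔮'def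
  have h𝔮' : 𝔮'.asIdeal.height = 1 := by rw [h𝔮'def, Kato2004.height_comap_invol]; exact h𝔮
  have hp𝔮' : PowerSeries.C (2 : ℤ_[2]) ∉ 𝔮'.asIdeal := by
    intro h
    apply hp𝔮
    rw [h𝔮'def, PrimeSpectrum.comap_asIdeal, Ideal.mem_comap] at h
    change IwasawaAlgebra.invol 2 (PowerSeries.C (2 : ℤ_[2])) ∈ 𝔮.asIdeal at h
    rwa [IwasawaAlgebra.invol_C] at h
  -- symmetry for the key-`γ` datum `D₀` at `ι𝔮`, transported to `D′`
  have hsym := lengthAt_selmerDual_symm_of_model h114 h114F W' hmult' W hV hθ κ γ hκ hγ hγθ D₀' hD₀' D₀ hD₀ F hF κF γF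
    hκF hγF DF ΘS hΘS 𝔮' h𝔮' hp𝔮'
  have hXsym : lengthAt (IwasawaAlgebra 2) D'.X 𝔮 = lengthAt (IwasawaAlgebra 2) D'.X 𝔮' := by
    rw [Kato2004.selmerDualData_lengthAt_inv_eq D₀ D' 𝔮, Kato2004.selmerDualData_lengthAt_inv_eq D₀ D' 𝔮', ← h𝔮'def,
      hsym, h𝔮'def, Kato2004.comap_invol_comap_invol]
  exact MultOddBranchFE.lengthAt_selmerDualContra_le_of_oddBranchInputsPrintExact_of_lengthAt_symm_fe h12 hPE W f κ γ hsp
    hirr hκ hγ hγ' hf I D' Lt m hLt hLt0 𝔮 h𝔮 hp𝔮 hXsym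

include h12 hPE h114 h114F hmult' hV hθ hsp hirr hκ hγ hγ' hγθ hf I hD₀' hD₀ hF hκF hγF DF hΘS hLt hLt0 in
/-- **KEY-`γ` DOOR with T20 (a) and T20 (d) in the kernel (modulo the model)**: `ℓ_𝔮(X(W/ℚ_∞)) ≤ ℓ_𝔮(Λ/(L̃))` at every
height-one `𝔮 ∌ 2` for every key-`γ` dual Selmer datum `D` of the additive `W` — the key-`γ⁻¹` door at `ι𝔮` for a
key-`γ⁻¹` datum (`Kato2004.selmerDualData_exists_involTwist`), transported back by
`Kato2004.selmerDualData_lengthAt_eq_inv` and the functional equation (`MultOddBranchFE.map_invol_span_eq_of_eq_oddBranchMult_two_of_split`,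
`Kato2004.lengthAt_quotient_span_eq_comap_invol_of_map_invol_span_eq`). Compared with addL2x's
`AddKatoTwo.lengthAt_selmerDual_le_of_oddBranchInputsPrintExact` / t42 GEN 21's `…_fe`: the binder `hXι` is REPLACED by
{Greenberg 1.14 ×2 (PRINT), torsion of `X(W′/ℚ_∞)`, `X(W/ℚ_∞)`, the model identification}.
[cite: Kato2004Asterisque, Thm. 12.4 (2) (p. 221), Thm. 12.5 (3) and (12.5.1) (p. 222), §17.13 (pp. 279–280)]
[cite: GreenbergLNM1716, Thm. 1.14 (p. 68)] [cite: MazurTateTeitelbaum1986Invent, §I.17] -/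
theorem lengthAt_selmerDual_le_of_oddBranchInputsPrintExact_fe_of_model (D : W.SelmerDualData κ γ)
    (𝔮 : PrimeSpectrum (IwasawaAlgebra 2)) (h𝔮 : 𝔮.asIdeal.height = 1) (hp𝔮 : PowerSeries.C (2 : ℤ_[2]) ∉ 𝔮.asIdeal) :
    lengthAt (IwasawaAlgebra 2) D.X 𝔮 ≤ lengthAt (IwasawaAlgebra 2) (IwasawaAlgebra 2 ⧸ Ideal.span {Lt}) 𝔮 := by
  haveI : Fact (Nat.Prime 2) := ⟨Nat.prime_two⟩
  obtain ⟨D', _e, _he, -⟩ := Kato2004.selmerDualData_exists_involTwist (mul_inv_cancel γ) D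
  set 𝔮' := PrimeSpectrum.comap (IwasawaAlgebra.invol 2).toRingHom 𝔮 with h𝔮'def
  have h𝔮' : 𝔮'.asIdeal.height = 1 := by rw [h𝔮'def, Kato2004.height_comap_invol]; exact h𝔮
  have hp𝔮' : PowerSeries.C (2 : ℤ_[2]) ∉ 𝔮'.asIdeal := by
    intro h
    apply hp𝔮
    rw [h𝔮'def, PrimeSpectrum.comap_asIdeal, Ideal.mem_comap] at h
    change IwasawaAlgebra.invol 2 (PowerSeries.C (2 : ℤ_[2])) ∈ 𝔮.asIdeal at h
    rwa [IwasawaAlgebra.invol_C] at h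
  have hA := lengthAt_selmerDualContra_le_of_oddBranchInputsPrintExact_fe_of_model h12 hPE h114 h114F W W' hmult' hV hθ f κ γ
    hsp hirr hκ hγ hγ' hγθ hf I D₀' hD₀' D₀ hD₀ F hF κF γF hκF hγF DF ΘS hΘS Lt m hLt hLt0 D' 𝔮' h𝔮' hp𝔮'
  rw [Kato2004.selmerDualData_lengthAt_eq_inv D D' 𝔮,
    Kato2004.lengthAt_quotient_span_eq_comap_invol_of_map_invol_span_eq
      (MultOddBranchFE.map_invol_span_eq_of_eq_oddBranchMult_two_of_split hsp hf hLt) 𝔮]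
  exact hA

end Doors

end Summit.BirchSwinnertonDyer.BirchSwinnertonDyer.Theorems.AddKatoTwoQuadLayer

end
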